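import Mathlib
import HarnessLib
import Summits.AtomisticToContinuum.BoseEinsteinCondensation.Theses.GapWindowLadder
import Summits.AtomisticToContinuum.BoseEinsteinCondensation.Theorems.GapWindowLadderMixingTransferAux

/-!
# Route GapWindowLadder — support item `MixingTransfer` (stmt-AtomisticToContinuum-27584), BY NAME

decomp-a2c lens-6 g13 (X twin owed since critic row 120: "X = MixingTransfer is NEW and must be LANDED
or PROOF-READY before any NODE treats it as routine").

THE CONVEXITY HALF OF THE HELLMANN–FEYNMAN TRANSFER, in loss currency, at one level `k` and one rate `r`:
a loss law `r·16⁻¹pairloss_k(Φ) ≤ (E(Φ) − E₀) + r·a·N` known only for states INSIDE the energy window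
`E(Φ) ≤ E₀ + r·a·N` holds for ALL admissible states at rate `r/64` with allowance `a` (i.e. additive error
`(r/64)·a·N`). Proof (parallelogram only — no spectral theory, no ground state, every measurable `v`
including hard cores): inside the window scale the law by `1/64`; if `E(Φ) = ⊤` the right-hand side is `⊤`;
otherwise `X := E(Φ) − E₀ > W := r a N > 0` is finite, pick a `W/16`-near-minimiser `Ψ` and
`t := W/(16X) < 1/16`, and form `m_± := √(1−t)·Ψ ± √t·Φ`. The `L²` masses satisfy `n₊ + n₋ = 2` and
(Young) `n_± ≤ 3/2`, so `n_± ≥ 1/2`; the raw energies satisfy `Q(m₊) + Q(m₋) = 2(1−t)E(Ψ) + 2tE(Φ) ≤ 2E₀ + W/4`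
and `Q(m) ≥ E₀·n(m)` (normalise), so each normalised `m_s/√n_s` lies in the window with excess `≤ W/(4n_s)`;
the pair losses satisfy `P(m₊) + P(m₋) = 2(1−t)P(Ψ) + 2tP(Φ) ≥ 2tP(Φ)`, so for the sign `s` with the larger
loss `P(m_s) ≥ tP(Φ)`; the window law at `m_s/√n_s` gives `r·t·P(Φ) ≤ W/4 + n_s W ≤ 7W/4`, i.e.
`r·P(Φ) ≤ 28·X`, whence `(r/64)·P(Φ) ≤ X`.

The analytic identities (parallelogram and scaling laws for the Dirichlet energy form, the `L²` mass and the
pair-loss functional; the normalising constructor; `E₀‖U‖² ≤ q_v(U)`) are in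
`Theorems/GapWindowLadderMixingTransferAux.lean`; this file is the bookkeeping and the item.
-/

noncomputable section

namespace Summit.AtomisticToContinuum.BoseEinsteinCondensation.Theorems.GapWindowLadderMixingTransfer

open scoped BigOperators ENNReal NNReal ComplexConjugate
open Filter MeasureTheory
open Literature.MathematicalPhysics.QuantumManyBody.BoseGas
open Summit.AtomisticToContinuum.BoseEinsteinCondensation.Theorems.GapWindowLadderMixingTransferAux

variable {n N : ℕ} {L : ℝ} {v : ℝ → ℝ≥0∞}

/-! ## The bookkeeping (pure `ℝ≥0∞` / `ℝ` arithmetic) -/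

/-- THE BOOKKEEPING of the mixing argument, abstract in the masses `Mu, Mw`, raw energies `Eu, Ew`,
raw pair losses `Pu, Pw` of `m_u, m_w = √(1−t)Ψ ± √tΦ` (`u` the sign with the larger loss), the data of
`Ψ` (`EΨ ≤ E₀ + W/16`, `PΨ`) and of `Φ` (`EΦ = E₀ + X`, `PΦ`), `W = r a N`, `t = W/(16X)`:
the window law at the normalised `m_u` forces `r·PΦ ≤ 28·X`. -/
private theorem mt_bookkeeping {E₀ EΨ EΦ Eu Ew Mu Mw Pu Pw PΨ PΦ X : ℝ≥0∞} {r Wr Xr t : ℝ}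
    (hWr : 0 < Wr) (hWX : Wr < Xr) (ht : t = Wr / (16 * Xr))
    (hE₀ : E₀ ≠ ⊤) (hX : X = ENNReal.ofReal Xr) (hEΦ : EΦ = E₀ + X)
    (hEΨ : EΨ ≤ E₀ + ENNReal.ofReal (Wr / 16))
    (hEpar : Eu + Ew = 2 * (ENNReal.ofReal (1 - t) * EΨ) + 2 * (ENNReal.ofReal t * EΦ))
    (hMpar : Mu + Mw = 2) (hMu : 2 * Mu ≤ 3) (hMw : 2 * Mw ≤ 3)
    (hPpar : Pu + Pw = 2 * (ENNReal.ofReal (1 - t) * PΨ) + 2 * (ENNReal.ofReal t * PΦ))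
    (hPwu : Pw ≤ Pu) (hlow : E₀ * Mw ≤ Ew)
    (hlaw : Mu ≠ 0 → Mu ≠ ⊤ → Mu⁻¹ * Eu ≤ E₀ + ENNReal.ofReal Wr →
      ENNReal.ofReal r * (Mu⁻¹ * Pu) ≤ (Mu⁻¹ * Eu - E₀) + ENNReal.ofReal Wr) :
    ENNReal.ofReal r * PΦ ≤ 28 * X := by
  have hXr : 0 < Xr := hWr.trans hWX
  have ht0 : 0 < t := by rw [ht]; positivity
  have ht1 : t < 1 / 16 := by
    rw [ht, div_lt_div_iff₀ (by positivity) (by norm_num)]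
    linarith
  have h3top : (3 : ℝ≥0∞) ≠ ⊤ := ENNReal.ofNat_ne_top
  have h2top : (2 : ℝ≥0∞) ≠ ⊤ := ENNReal.ofNat_ne_top
  -- masses: finite, and `Mu ≥ 1/2`
  have hMut : Mu ≠ ⊤ := by
    intro h; rw [h, ENNReal.mul_top two_ne_zero] at hMu; exact absurd hMu (by simp)
  have hMwt : Mw ≠ ⊤ := by
    intro h; rw [h, ENNReal.mul_top two_ne_zero] at hMw; exact absurd hMw (by simp)
  have h1Mu : 1 ≤ 2 * Mu := by
    have h4 : (1 : ℝ≥0∞) + 3 ≤ 2 * Mu + 3 := by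
      calc (1 : ℝ≥0∞) + 3 = 2 * (Mu + Mw) := by rw [hMpar]; norm_num
        _ = 2 * Mu + 2 * Mw := mul_add _ _ _
        _ ≤ 2 * Mu + 3 := add_le_add le_rfl hMw
    exact (ENNReal.add_le_add_iff_right h3top).1 h4
  have hMu0 : Mu ≠ 0 := by
    intro h; rw [h, mul_zero] at h1Mu; exact absurd h1Mu (by simp)
  have hMuinv : Mu⁻¹ ≤ 2 := by
    rw [ENNReal.inv_le_iff_le_mul (fun h => absurd h h2top) (fun _ => two_ne_zero), mul_comm]
    exact h1Mu
  -- numerals as `ofReal`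
  have e2 : (2 : ℝ≥0∞) = ENNReal.ofReal 2 := (ENNReal.ofReal_ofNat 2).symm
  have e3 : (3 : ℝ≥0∞) = ENNReal.ofReal 3 := (ENNReal.ofReal_ofNat 3).symm
  have e4 : (4 : ℝ≥0∞) = ENNReal.ofReal 4 := (ENNReal.ofReal_ofNat 4).symm
  have e28 : (28 : ℝ≥0∞) = ENNReal.ofReal 28 := (ENNReal.ofReal_ofNat 28).symm
  have htX : ENNReal.ofReal t * X = ENNReal.ofReal (Wr / 16) := by
    rw [hX, ← ENNReal.ofReal_mul ht0.le]
    congr 1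
    rw [ht]
    field_simp
  have htsum : ENNReal.ofReal (1 - t) + ENNReal.ofReal t = 1 := by
    rw [← ENNReal.ofReal_add (by linarith) ht0.le, sub_add_cancel, ENNReal.ofReal_one]
  have h1t : ENNReal.ofReal (1 - t) ≤ 1 := ENNReal.ofReal_le_one.2 (by linarith)
  -- energies: `Eu + Ew ≤ 2E₀ + W/4`
  have hsum : Eu + Ew ≤ 2 * E₀ + ENNReal.ofReal (Wr / 4) := by
    rw [hEpar]
    have hA : ENNReal.ofReal (1 - t) * EΨ ≤
        ENNReal.ofReal (1 - t) * E₀ + ENNReal.ofReal (Wr / 16) := by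
      calc ENNReal.ofReal (1 - t) * EΨ
          ≤ ENNReal.ofReal (1 - t) * (E₀ + ENNReal.ofReal (Wr / 16)) := mul_le_mul' le_rfl hEΨ
        _ = ENNReal.ofReal (1 - t) * E₀ + ENNReal.ofReal (1 - t) * ENNReal.ofReal (Wr / 16) :=
            mul_add _ _ _
        _ ≤ ENNReal.ofReal (1 - t) * E₀ + 1 * ENNReal.ofReal (Wr / 16) :=
            add_le_add le_rfl (mul_le_mul' h1t le_rfl)
        _ = _ := by rw [one_mul]
    have hB : ENNReal.ofReal t * EΦ = ENNReal.ofReal t * E₀ + ENNReal.ofReal (Wr / 16) := by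
      rw [hEΦ, mul_add, htX]
    rw [hB]
    calc 2 * (ENNReal.ofReal (1 - t) * EΨ) + 2 * (ENNReal.ofReal t * E₀ + ENNReal.ofReal (Wr / 16))
        ≤ 2 * (ENNReal.ofReal (1 - t) * E₀ + ENNReal.ofReal (Wr / 16)) +
            2 * (ENNReal.ofReal t * E₀ + ENNReal.ofReal (Wr / 16)) :=
          add_le_add (mul_le_mul' le_rfl hA) le_rfl
      _ = 2 * ((ENNReal.ofReal (1 - t) + ENNReal.ofReal t) * E₀) + 4 * ENNReal.ofReal (Wr / 16) := by
          ring
      _ = 2 * E₀ + ENNReal.ofReal (Wr / 4) := by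
          rw [htsum, one_mul, e4, ← ENNReal.ofReal_mul (by norm_num)]
          congr 2
          ring
  -- the raw energy of `m_u`: `Eu ≤ Mu E₀ + W/4`
  have hEu : Eu ≤ Mu * E₀ + ENNReal.ofReal (Wr / 4) := by
    have h2E₀ : 2 * E₀ = Mu * E₀ + Mw * E₀ := by rw [← add_mul, hMpar]
    have h : Eu + Mw * E₀ ≤ Mu * E₀ + ENNReal.ofReal (Wr / 4) + Mw * E₀ := by
      calc Eu + Mw * E₀ ≤ Eu + Ew := add_le_add le_rfl (by rw [mul_comm]; exact hlow)
        _ ≤ 2 * E₀ + ENNReal.ofReal (Wr / 4) := hsum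
        _ = _ := by rw [h2E₀]; ring
    exact (ENNReal.add_le_add_iff_right (ENNReal.mul_ne_top hMwt hE₀)).1 h
  -- the normalised `m_u` lies in the window, with excess `≤ Mu⁻¹ W/4`
  have hwinU : Mu⁻¹ * Eu ≤ E₀ + Mu⁻¹ * ENNReal.ofReal (Wr / 4) := by
    calc Mu⁻¹ * Eu ≤ Mu⁻¹ * (Mu * E₀ + ENNReal.ofReal (Wr / 4)) := mul_le_mul' le_rfl hEu
      _ = Mu⁻¹ * Mu * E₀ + Mu⁻¹ * ENNReal.ofReal (Wr / 4) := by rw [mul_add, mul_assoc]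
      _ = E₀ + Mu⁻¹ * ENNReal.ofReal (Wr / 4) := by rw [ENNReal.inv_mul_cancel hMu0 hMut, one_mul]
  have hwinU' : Mu⁻¹ * Eu ≤ E₀ + ENNReal.ofReal Wr := by
    refine hwinU.trans (add_le_add le_rfl ?_)
    calc Mu⁻¹ * ENNReal.ofReal (Wr / 4) ≤ 2 * ENNReal.ofReal (Wr / 4) := mul_le_mul' hMuinv le_rfl
      _ = ENNReal.ofReal (Wr / 2) := by rw [e2, ← ENNReal.ofReal_mul (by norm_num)]; congr 1; ring
      _ ≤ ENNReal.ofReal Wr := ENNReal.ofReal_le_ofReal (by linarith)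
  have hexcU : Mu⁻¹ * Eu - E₀ ≤ Mu⁻¹ * ENNReal.ofReal (Wr / 4) :=
    tsub_le_iff_right.2 (by rw [add_comm]; exact hwinU)
  -- the window law at the normalised `m_u`, de-normalised: `r Pu ≤ W/4 + Mu W`
  have hL := (hlaw hMu0 hMut hwinU').trans (add_le_add hexcU le_rfl)
  have hrPu : ENNReal.ofReal r * Pu ≤ ENNReal.ofReal (Wr / 4) + Mu * ENNReal.ofReal Wr := by
    have h : Mu * (ENNReal.ofReal r * (Mu⁻¹ * Pu)) ≤ Mu * (Mu⁻¹ * ENNReal.ofReal (Wr / 4) + ENNReal.ofReal Wr) :=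
      mul_le_mul' le_rfl hL
    have e1 : Mu * (ENNReal.ofReal r * (Mu⁻¹ * Pu)) = ENNReal.ofReal r * Pu := by
      calc Mu * (ENNReal.ofReal r * (Mu⁻¹ * Pu)) = Mu * Mu⁻¹ * (ENNReal.ofReal r * Pu) := by ring
        _ = ENNReal.ofReal r * Pu := by rw [ENNReal.mul_inv_cancel hMu0 hMut, one_mul]
    have e1' : Mu * (Mu⁻¹ * ENNReal.ofReal (Wr / 4) + ENNReal.ofReal Wr) =
        ENNReal.ofReal (Wr / 4) + Mu * ENNReal.ofReal Wr := by
      rw [mul_add, ← mul_assoc, ENNReal.mul_inv_cancel hMu0 hMut, one_mul]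
    rwa [e1, e1'] at h
  have h2rPu : 2 * (ENNReal.ofReal r * Pu) ≤ ENNReal.ofReal (7 * Wr / 2) := by
    calc 2 * (ENNReal.ofReal r * Pu) ≤ 2 * (ENNReal.ofReal (Wr / 4) + Mu * ENNReal.ofReal Wr) :=
          mul_le_mul' le_rfl hrPu
      _ = 2 * ENNReal.ofReal (Wr / 4) + 2 * Mu * ENNReal.ofReal Wr := by ring
      _ ≤ 2 * ENNReal.ofReal (Wr / 4) + 3 * ENNReal.ofReal Wr :=
          add_le_add le_rfl (mul_le_mul' hMu le_rfl)
      _ = ENNReal.ofReal (7 * Wr / 2) := by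
          rw [e2, e3, ← ENNReal.ofReal_mul (by norm_num), ← ENNReal.ofReal_mul (by norm_num),
            ← ENNReal.ofReal_add (by positivity) (by positivity)]
          congr 1
          ring
  -- losses: `t PΦ ≤ Pu`
  have htP : ENNReal.ofReal t * PΦ ≤ Pu := by
    have h : 2 * (ENNReal.ofReal t * PΦ) ≤ 2 * Pu := by
      calc 2 * (ENNReal.ofReal t * PΦ)
          ≤ 2 * (ENNReal.ofReal (1 - t) * PΨ) + 2 * (ENNReal.ofReal t * PΦ) := le_add_self
        _ = Pu + Pw := hPpar.symm
        _ ≤ Pu + Pu := add_le_add le_rfl hPwu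
        _ = 2 * Pu := (two_mul Pu).symm
    exact (ENNReal.mul_le_mul_iff_right two_ne_zero h2top).1 h
  -- combine: `t · 2 r PΦ ≤ 2 r Pu ≤ 7W/2 = t · 56 X`
  have hfin : ENNReal.ofReal t * (2 * (ENNReal.ofReal r * PΦ)) ≤ ENNReal.ofReal t * (2 * (28 * X)) := by
    calc ENNReal.ofReal t * (2 * (ENNReal.ofReal r * PΦ))
        = 2 * (ENNReal.ofReal r * (ENNReal.ofReal t * PΦ)) := by ring
      _ ≤ 2 * (ENNReal.ofReal r * Pu) := mul_le_mul' le_rfl (mul_le_mul' le_rfl htP)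
      _ ≤ ENNReal.ofReal (7 * Wr / 2) := h2rPu
      _ = ENNReal.ofReal (t * (2 * (28 * Xr))) := by
          congr 1
          rw [ht]
          field_simp
          ring
      _ = ENNReal.ofReal t * (2 * (28 * X)) := by
          rw [ENNReal.ofReal_mul ht0.le, ENNReal.ofReal_mul (by norm_num),
            ENNReal.ofReal_mul (by norm_num), hX, ← e2, ← e28]
  have h2 := (ENNReal.mul_le_mul_iff_right (ENNReal.ofReal_pos.2 ht0).ne' ENNReal.ofReal_ne_top).1 hfin
  exact (ENNReal.mul_le_mul_iff_right two_ne_zero h2top).1 h2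

/-! ## The item, by name -/

/-- **`MixingTransfer` holds** (route GapWindowLadder, item stmt-AtomisticToContinuum-27584): a loss law at
rate `r` with allowance `a`, known inside the energy window `E ≤ E₀ + r a N`, holds for all admissible states
at rate `r/64` with the same allowance. -/
theorem mixingTransfer :
    Summit.AtomisticToContinuum.BoseEinsteinCondensation.Theses.GapWindowLadder.MixingTransfer := by
  intro v hv ρ N
  rcases N with _ | n
  · -- no particles: every occupation vanishes
    intro k r a hr ha hlaw Φ
    simp [occupation]
  intro k r a hr ha hlaw
  set L := sideLength ρ (n + 1) with hLdef
  set E₀ := groundStateEnergy v (n + 1) L with hE₀def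
  intro Φ
  -- the pair-loss functional of level `k`
  obtain ⟨P, hP⟩ : ∃ P : (Config (n + 1) → ℂ) → ℝ≥0∞, ∀ χ, P χ =
      (16 : ℝ≥0∞)⁻¹ * ∑ q : SubIdx (2 ^ k), ∑ q' ∈ Finset.univ.filter
        (fun q' : SubIdx (2 ^ k) => q ≠ q' ∧ ∀ j : Fin 3, (q j : ℕ) / 2 = (q' j : ℕ) / 2),
        occupation (n + 1) (fun x => subMode (L / 2 ^ k) q x - subMode (L / 2 ^ k) q' x) χ :=
    ⟨_, fun _ => rfl⟩
  simp only [← hP] at hlaw ⊢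
  set Wr : ℝ := r * a * ((n + 1 : ℕ) : ℝ) with hWrdef
  have hWr : 0 < Wr := by positivity
  -- the final rescaling `r P ≤ 28 X ⇒ (r/64) P ≤ X + (r/64) a N`
  have final : ENNReal.ofReal r * P Φ.ψ ≤ 28 * (energy v Φ - E₀) →
      ENNReal.ofReal (r / 64) * P Φ.ψ ≤ (energy v Φ - E₀) + ENNReal.ofReal (r / 64 * a * ((n + 1 : ℕ) : ℝ)) := by
    intro h28
    have e1 : ENNReal.ofReal (r / 64) = ENNReal.ofReal (1 / 64) * ENNReal.ofReal r := by
      rw [← ENNReal.ofReal_mul (by norm_num)]; congr 1; ring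
    rw [e1, mul_assoc]
    calc ENNReal.ofReal (1 / 64) * (ENNReal.ofReal r * P Φ.ψ)
        ≤ ENNReal.ofReal (1 / 64) * (28 * (energy v Φ - E₀)) := mul_le_mul' le_rfl h28
      _ = ENNReal.ofReal (28 / 64) * (energy v Φ - E₀) := by
          rw [← mul_assoc, ← ENNReal.ofReal_ofNat 28, ← ENNReal.ofReal_mul (by norm_num)]
          congr 2
          norm_num
      _ ≤ 1 * (energy v Φ - E₀) := mul_le_mul' (ENNReal.ofReal_le_one.2 (by norm_num)) le_rfl
      _ ≤ _ := by rw [one_mul]; exact le_self_add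
  by_cases hwin : energy v Φ ≤ E₀ + ENNReal.ofReal Wr
  · -- inside the window: the law at rate `r`, scaled by `1/64`
    have h := hlaw Φ hwin
    have e1 : ENNReal.ofReal (r / 64) = ENNReal.ofReal (1 / 64) * ENNReal.ofReal r := by
      rw [← ENNReal.ofReal_mul (by norm_num)]; congr 1; ring
    have e2 : ENNReal.ofReal (r / 64 * a * ((n + 1 : ℕ) : ℝ)) = ENNReal.ofReal (1 / 64) * ENNReal.ofReal Wr := by
      rw [← ENNReal.ofReal_mul (by norm_num)]; congr 1; rw [hWrdef]; ring
    rw [e1, e2, mul_assoc]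
    calc ENNReal.ofReal (1 / 64) * (ENNReal.ofReal r * P Φ.ψ)
        ≤ ENNReal.ofReal (1 / 64) * ((energy v Φ - E₀) + ENNReal.ofReal Wr) := mul_le_mul' le_rfl h
      _ = ENNReal.ofReal (1 / 64) * (energy v Φ - E₀) + ENNReal.ofReal (1 / 64) * ENNReal.ofReal Wr :=
          mul_add _ _ _
      _ ≤ 1 * (energy v Φ - E₀) + ENNReal.ofReal (1 / 64) * ENNReal.ofReal Wr :=
          add_le_add (mul_le_mul' (ENNReal.ofReal_le_one.2 (by norm_num)) le_rfl) le_rfl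
      _ = _ := by rw [one_mul]
  -- outside the window
  rw [not_le] at hwin
  have hE₀top : E₀ ≠ ⊤ := by
    intro h; rw [h, top_add] at hwin; exact absurd hwin not_top_lt
  by_cases hΦtop : energy v Φ = ⊤
  · rw [hΦtop, ENNReal.top_sub hE₀top, top_add]; exact le_top
  apply final
  -- the main case: `E₀ + W < E(Φ) < ⊤`
  have hE₀le : E₀ ≤ energy v Φ := groundStateEnergy_le_energy v Φ
  set X := energy v Φ - E₀ with hXdef
  have hEΦ : energy v Φ = E₀ + X := (add_tsub_cancel_of_le hE₀le).symm
  have hXtop : X ≠ ⊤ := ENNReal.sub_ne_top hΦtop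
  have hWX : ENNReal.ofReal Wr < X := by
    rw [hEΦ] at hwin
    exact (ENNReal.add_lt_add_iff_left hE₀top).1 hwin
  set Xr : ℝ := X.toReal with hXrdef
  have hX : X = ENNReal.ofReal Xr := (ENNReal.ofReal_toReal hXtop).symm
  have hWXr : Wr < Xr := by
    have h := hWX
    rw [hX, ENNReal.ofReal_lt_ofReal_iff'] at h
    exact h.1
  have hXr : 0 < Xr := hWr.trans hWXr
  set t : ℝ := Wr / (16 * Xr) with ht
  have ht0 : 0 < t := by positivity
  have ht1 : t < 1 / 16 := by
    rw [ht, div_lt_div_iff₀ (by positivity) (by norm_num)]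
    linarith
  -- a `W/16`-near-minimiser `Ψ`
  obtain ⟨Ψ, hΨ⟩ : ∃ Ψ : TrialState (n + 1) L, energy v Ψ ≤ E₀ + ENNReal.ofReal (Wr / 16) := by
    have h : E₀ < E₀ + ENNReal.ofReal (Wr / 16) :=
      ENNReal.lt_add_right hE₀top (ENNReal.ofReal_pos.2 (by positivity)).ne'
    rw [hE₀def, groundStateEnergy] at h
    obtain ⟨Ψ, hΨ⟩ := iInf_lt_iff.1 h
    exact ⟨Ψ, hΨ.le⟩
  -- the coefficients `α = √(1−t)`, `β = √t`
  set α : ℝ := Real.sqrt (1 - t) with hαdef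
  set β : ℝ := Real.sqrt t with hβdef
  have hα2 : ((‖(α : ℂ)‖₊ : ℝ≥0∞)) ^ 2 = ENNReal.ofReal (1 - t) := by
    rw [coe_nnnorm_sq_eq_ofReal, Complex.norm_real, hαdef, Real.norm_of_nonneg (Real.sqrt_nonneg _),
      Real.sq_sqrt (by linarith)]
  have hβ2 : ((‖(β : ℂ)‖₊ : ℝ≥0∞)) ^ 2 = ENNReal.ofReal t := by
    rw [coe_nnnorm_sq_eq_ofReal, Complex.norm_real, hβdef, Real.norm_of_nonneg (Real.sqrt_nonneg _),
      Real.sq_sqrt ht0.le]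
  -- the raw functionals
  obtain ⟨M, hM⟩ : ∃ M : (Config (n + 1) → ℂ) → ℝ≥0∞, ∀ χ, M χ = ∫⁻ X, ((‖χ X‖₊ : ℝ≥0∞)) ^ 2 :=
    ⟨_, fun _ => rfl⟩
  obtain ⟨Er, hEr⟩ : ∃ Er : (Config (n + 1) → ℂ) → ℝ≥0∞, ∀ χ, Er χ =
      ∫⁻ X, kineticDensity χ X + interaction v X * ((‖χ X‖₊ : ℝ≥0∞)) ^ 2 := ⟨_, fun _ => rfl⟩
  have hErΨ : ∀ Θ : TrialState (n + 1) L, energy v Θ = Er Θ.ψ := fun Θ => by rw [hEr]; rfl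
  -- analytic facts about `f = αΨ`, `g = βΦ`, `u = f + g`, `w = f - g`
  have hv' : Measurable v := hv.1
  have hfC : ContDiff ℝ 1 (fun X => (α : ℂ) * Ψ.ψ X) := contDiff_const.mul Ψ.contDiff
  have hgC : ContDiff ℝ 1 (fun X => (β : ℂ) * Φ.ψ X) := contDiff_const.mul Φ.contDiff
  have huC : ContDiff ℝ 1 (fun X => (α : ℂ) * Ψ.ψ X + (β : ℂ) * Φ.ψ X) := hfC.add hgC
  have hwC : ContDiff ℝ 1 (fun X => (α : ℂ) * Ψ.ψ X - (β : ℂ) * Φ.ψ X) := hfC.sub hgC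
  have h0u : ∀ X, X ∉ boxN (n + 1) L → (fun X => (α : ℂ) * Ψ.ψ X + (β : ℂ) * Φ.ψ X) X = 0 :=
    fun X hX => by simp only [Ψ.eq_zero X hX, Φ.eq_zero X hX, mul_zero, add_zero]
  have h0w : ∀ X, X ∉ boxN (n + 1) L → (fun X => (α : ℂ) * Ψ.ψ X - (β : ℂ) * Φ.ψ X) X = 0 :=
    fun X hX => by simp only [Ψ.eq_zero X hX, Φ.eq_zero X hX, mul_zero, sub_zero]
  have hsyu : ∀ (σ : Equiv.Perm (Fin (n + 1))) (X : Config (n + 1)),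
      (fun X => (α : ℂ) * Ψ.ψ X + (β : ℂ) * Φ.ψ X) (X ∘ σ) =
        (fun X => (α : ℂ) * Ψ.ψ X + (β : ℂ) * Φ.ψ X) X := fun σ X => by simp only [Ψ.symm, Φ.symm]
  have hsyw : ∀ (σ : Equiv.Perm (Fin (n + 1))) (X : Config (n + 1)),
      (fun X => (α : ℂ) * Ψ.ψ X - (β : ℂ) * Φ.ψ X) (X ∘ σ) =
        (fun X => (α : ℂ) * Ψ.ψ X - (β : ℂ) * Φ.ψ X) X := fun σ X => by simp only [Ψ.symm, Φ.symm]
  have hMf : M (fun X => (α : ℂ) * Ψ.ψ X) = ENNReal.ofReal (1 - t) := by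
    rw [hM, mass_const_mul, Ψ.norm_eq, mul_one, hα2]
  have hMg : M (fun X => (β : ℂ) * Φ.ψ X) = ENNReal.ofReal t := by
    rw [hM, mass_const_mul, Φ.norm_eq, mul_one, hβ2]
  have hEf : Er (fun X => (α : ℂ) * Ψ.ψ X) = ENNReal.ofReal (1 - t) * energy v Ψ := by
    rw [hEr, hErΨ, hEr, energyForm_const_mul v (α : ℂ) Ψ.contDiff, hα2]
  have hEg : Er (fun X => (β : ℂ) * Φ.ψ X) = ENNReal.ofReal t * energy v Φ := by
    rw [hEr, hErΨ, hEr, energyForm_const_mul v (β : ℂ) Φ.contDiff, hβ2]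
  have hPf : P (fun X => (α : ℂ) * Ψ.ψ X) = ENNReal.ofReal (1 - t) * P Ψ.ψ := by
    rw [hP, hP, pairLoss_const_mul, hα2]
  have hPg : P (fun X => (β : ℂ) * Φ.ψ X) = ENNReal.ofReal t * P Φ.ψ := by
    rw [hP, hP, pairLoss_const_mul, hβ2]
  have hMpar : M (fun X => (α : ℂ) * Ψ.ψ X + (β : ℂ) * Φ.ψ X) +
      M (fun X => (α : ℂ) * Ψ.ψ X - (β : ℂ) * Φ.ψ X) = 2 := by
    rw [hM, hM, mass_add_add_sub hfC.continuous hgC.continuous, ← hM, ← hM, hMf, hMg,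
      ← mul_add, ← ENNReal.ofReal_add (by linarith) ht0.le, sub_add_cancel, ENNReal.ofReal_one, mul_one]
  have hYoung : ENNReal.ofReal (8 / 3) * M (fun X => (α : ℂ) * Ψ.ψ X) +
      ENNReal.ofReal 8 * M (fun X => (β : ℂ) * Φ.ψ X) ≤ 3 := by
    rw [hMf, hMg, ← ENNReal.ofReal_mul (by norm_num), ← ENNReal.ofReal_mul (by norm_num),
      ← ENNReal.ofReal_add (by nlinarith) (by positivity), ← ENNReal.ofReal_ofNat 3]
    exact ENNReal.ofReal_le_ofReal (by norm_num; linarith)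
  have hMu3 : 2 * M (fun X => (α : ℂ) * Ψ.ψ X + (β : ℂ) * Φ.ψ X) ≤ 3 := by
    have h := (two_mul_mass_le hfC.continuous hgC.continuous).1
    rw [← hM, ← hM, ← hM] at h
    exact h.trans hYoung
  have hMw3 : 2 * M (fun X => (α : ℂ) * Ψ.ψ X - (β : ℂ) * Φ.ψ X) ≤ 3 := by
    have h := (two_mul_mass_le hfC.continuous hgC.continuous).2
    rw [← hM, ← hM, ← hM] at h
    exact h.trans hYoung
  have hMtop : ∀ {U : Config (n + 1) → ℂ}, 2 * M U ≤ 3 → M U ≠ ⊤ := by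
    intro U h hU
    rw [hU, ENNReal.mul_top two_ne_zero] at h
    exact absurd h (by simp)
  have hEpar : Er (fun X => (α : ℂ) * Ψ.ψ X + (β : ℂ) * Φ.ψ X) +
      Er (fun X => (α : ℂ) * Ψ.ψ X - (β : ℂ) * Φ.ψ X) =
      2 * (ENNReal.ofReal (1 - t) * energy v Ψ) + 2 * (ENNReal.ofReal t * energy v Φ) := by
    rw [hEr, hEr, energyForm_add_add_sub hv' hfC hgC, ← hEr, ← hEr, hEf, hEg]
  have hPpar : P (fun X => (α : ℂ) * Ψ.ψ X + (β : ℂ) * Φ.ψ X) +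
      P (fun X => (α : ℂ) * Ψ.ψ X - (β : ℂ) * Φ.ψ X) =
      2 * (ENNReal.ofReal (1 - t) * P Ψ.ψ) + 2 * (ENNReal.ofReal t * P Φ.ψ) := by
    rw [hP, hP, pairLoss_add_add_sub, ← hP, ← hP, hPf, hPg]
  -- the variational lower bound and the window law for a normalised admissible `U`
  have hlow : ∀ {U : Config (n + 1) → ℂ}, ContDiff ℝ 1 U → (∀ X, X ∉ boxN (n + 1) L → U X = 0) →
      (∀ (σ : Equiv.Perm (Fin (n + 1))) (X : Config (n + 1)), U (X ∘ σ) = U X) → M U ≠ ⊤ →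
      E₀ * M U ≤ Er U := by
    intro U hU h0 hsy htop
    rw [hM, hEr]
    rw [hM] at htop
    exact groundStateEnergy_mul_mass_le v hU h0 hsy htop
  have hlawU : ∀ {U : Config (n + 1) → ℂ}, ContDiff ℝ 1 U → (∀ X, X ∉ boxN (n + 1) L → U X = 0) →
      (∀ (σ : Equiv.Perm (Fin (n + 1))) (X : Config (n + 1)), U (X ∘ σ) = U X) →
      M U ≠ 0 → M U ≠ ⊤ → (M U)⁻¹ * Er U ≤ E₀ + ENNReal.ofReal Wr →
      ENNReal.ofReal r * ((M U)⁻¹ * P U) ≤ ((M U)⁻¹ * Er U - E₀) + ENNReal.ofReal Wr := by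
    intro U hU h0 hsy hM0 hMt hwinU
    rw [hM] at hM0 hMt
    obtain ⟨Θ, c, hΘ, hc⟩ := exists_trialState_const_mul hU h0 hsy hM0 hMt
    have hE : energy v Θ = (M U)⁻¹ * Er U := by
      rw [hErΨ, hEr, hEr, hΘ, energyForm_const_mul v (c : ℂ) hU, hc, hM]
    have hPΘ : P Θ.ψ = (M U)⁻¹ * P U := by
      rw [hP, hP, hΘ, pairLoss_const_mul, hc, hM]
    have h := hlaw Θ (by rw [hE]; exact hwinU)
    rwa [hE, hPΘ] at h
  -- from here on `u`, `w` are abstract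
  set u : Config (n + 1) → ℂ := fun X => (α : ℂ) * Ψ.ψ X + (β : ℂ) * Φ.ψ X with hudef
  set w : Config (n + 1) → ℂ := fun X => (α : ℂ) * Ψ.ψ X - (β : ℂ) * Φ.ψ X with hwdef
  clear_value u w
  rcases le_total (P w) (P u) with hPwu | hPuw
  · exact mt_bookkeeping hWr hWXr ht hE₀top hX hEΦ hΨ hEpar hMpar hMu3 hMw3 hPpar hPwu
      (hlow hwC h0w hsyw (hMtop hMw3)) (hlawU huC h0u hsyu)
  · rw [add_comm] at hMpar hEpar hPpar
    exact mt_bookkeeping hWr hWXr ht hE₀top hX hEΦ hΨ hEpar hMpar hMw3 hMu3 hPpar hPuw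
      (hlow huC h0u hsyu (hMtop hMu3)) (hlawU hwC h0w hsyw)


end Summit.AtomisticToContinuum.BoseEinsteinCondensation.Theorems.GapWindowLadderMixingTransfer

end
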